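import Summits.QuantumFields.BalabanUV.T4Continuum.Support.B13Represents

/-!
# NE5 ∕ U3 — the termwise END FACE applied to the ASSEMBLED step model (row O1-e's `B13Represents.Assembly.step`): every
# IDENTIFICATION leaf (L01∕L02 MI-R, L03 base, L08r structure, d3 `TermRep`) DISCHARGED by construction, the remaining binders
# DISPLAYED by name — conclusion literally `T4OutputRate.NE5 outA outB W κ θ′ C₅`
# (claim table `t4/b2b-balaban-t4-ne5-p1/O1-CLAIM-TABLE-NE5-P1.md` row O1-e, follower; typer `t4/formal/NE5/DAG.md` end face E1)

Cell `pub-balaban`, unit `b2b-balaban-t4-ne5-formalise-leaf-09` (NE5 formalisation swarm, LEAF PROVER 09; row O1-e holder, module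
`B13Represents` p208313 ACCEPTED 95bd70ec66db).  Summits-side new work under the LEAN PLACEMENT RULE (cell bookkeeping; NOT a
Literature module; NO owner END-face module is edited — this is a NEW module applying a landed END face BY NAME).  HONEST
FRAMING: rung (B)+1 of the FINITE-VOLUME T⁴ continuum programme — NOT infinite volume, NOT a mass gap, NOT the Clay problem,
and **NOT A PROOF OF NE5**: the theorem below is an IMPLICATION whose wall binders (W2 = the termwise majorant ∕ budget ∕ line
analyticity of the (2.14)-terms on the class — cell GAPS G-ne5p1-1′, NOT PRINTED; W1 in row NE2's entry currency — NOT PRINTED;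
W4; the one-run slice budgets — W3, NOT PRINTED as stated; the one-run levels L05∕L06 — quoted SHAPES of [Balaban1987RG1] (1.18)
p. 263; the reach ∕ first-scales ∕ smallness numerics) are DISPLAYED HYPOTHESES, asserted nowhere.  HONEST DEPENDENCY (cell line,
verbatim): continuum YM on T⁴ ⇐ BetaPertH ∧ nine spine estimates (0/9 proved); BetaPertH ⇐ (D1) ∧ (D4) ∧ CAP+tail; G-an2-4
gates asym, D1 and NE2/3/4.

WHAT THIS FILE DOES.  `TermRepOfSeries.ne5_at_of_stepModel_series_slack_budget_scale_nat` (leaf-04, p207636 — the owner's termwise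
END `T4InputCauchyRateTermwise.ne5_at_of_stepModel_termwise_slack_budget_scale_nat` with `hrep` produced from `Out := ∑'`) is
applied to `M := 𝔄.step (𝔄.bHist E₀ cB)` and `T := B13StepTermFamily.term 𝒯 inc act`, with
* `hrA`, `hrB` := `Assembly.representsA hT` ∕ `representsB` (L01 under the transport READING, L02 hypothesis-free),
* `hbase`, `hbudget` := `Assembly.inBase` ∕ `baseBudget` (L03 from the displayed B-side slice budget + quoted L06 + signs),
* `hOp`, `hHist` := ROOM of the class radii (`rOp ≤ ROp`, `bHist + rHist ≤ RHist`),
* `hout` := `Assembly.outIsSeries` (`rfl`),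
* `haff`, `hblind`, `hhom` := by construction (row O1-c), `hunit` := `Assembly.insScaleBound` from the displayed A-side slice budget,
* `hop` := `Assembly.operatorRate_of_weightedEntrywise` from the DISPLAYED weighted entrywise two-run species rate (row NE2's object)
  + bounded raw suppliers + a margin floor (δ = c₁∕r₀),
and the rest passed through: `TermBound`∕`TermBudget`∕`TermLineAnalytic` on `ballClass (selfCtr raw histRef) ROp RHist` (W2 data,
wall O2), `InsertionRate` (W4), `DecayBound outA`∕`DecayBound outB` (L05∕L06 for the recursively defined outputs), the numerics.
Value: the binder list of `ne5_of_assembly` IS the swarm's census of what remains for NE5 on the assembled model — nothing of MI-R,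
L03, L08r or d3 is left.  0 sorry; no new axioms; nothing of the manuscripts under audit is asserted (KIND∕locus only).
-/

noncomputable section

open scoped BigOperators
open Metric Set

namespace Summit.QuantumFields.BalabanUV.T4Continuum.B13StepEnd

open Literature.MathematicalPhysics.QuantumFieldTheory.Balaban1983to89.T4OutputRate (Carriers Functional DecayBound NE5)
open Literature.MathematicalPhysics.QuantumFieldTheory.Balaban1983to89.T4InputCauchyRateData (StepModel)
open Literature.MathematicalPhysics.QuantumFieldTheory.Balaban1983to89.T4InputCauchyRateSpecies (ballClass BaseBudget)
open Literature.MathematicalPhysics.QuantumFieldTheory.Balaban1983to89.T4InputCauchyRateTermwise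
  (TermBound TermBudget TermLineAnalytic)
open Summit.QuantumFields.BalabanUV.T4Continuum.B13OpDatum (OpDatum)
open Summit.QuantumFields.BalabanUV.T4Continuum.B13OpDatumJunctions (RawBounded WeightedEntrywiseRate)
open Summit.QuantumFields.BalabanUV.T4Continuum.B13StepTermFamily (term)
open Summit.QuantumFields.BalabanUV.T4Continuum.B13Base (selfCtr)
open Summit.QuantumFields.BalabanUV.T4Continuum.B13Represents (Assembly)
open Summit.QuantumFields.BalabanUV.T4Continuum.TermRepOfSeries
  (outIsSeriesOn_of_outIsSeries ne5_at_of_stepModel_series_slack_budget_scale_nat)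

variable {C : Carriers} {E IOp Hist ι P J : Type*} [NormedAddCommGroup Hist] [NormedSpace ℂ Hist]
  (𝔄 : Assembly C E IOp Hist ι P J)

/-- [folklore] **THE TERMWISE END FACE ON THE ASSEMBLED STEP MODEL.**  For the model `𝔄.step (𝔄.bHist E₀ cB)` of row O1-e with
its recursively defined outputs `outA`∕`outB`: the transport READING, the DISPLAYED one-run slice budgets of both runs (W3-KIND;
B-side for the base, A-side for the feedback gain `cA`), the quoted one-run levels `DecayBound outA W EA₀ κ` ∕ `DecayBound outB W
E₀ κ` (L05∕L06 SHAPES), the DISPLAYED weighted entrywise two-run species rate `c₁·θ^k` with bounded raw suppliers and a margin floor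
`r₀` (W1 in row NE2's currency), the DISPLAYED insertion rate `δ′` (W4), the DISPLAYED termwise data of the (2.14)-terms on the roomy
class `ballClass (selfCtr raw histRef) ROp RHist` — `TermBound κ a`, `TermBudget a G`, `TermLineAnalytic` (W2, wall O2) — the two
room inequalities, and the numerics (reach at `k₀`, first scales `B`, smallness `ω + G·cA∕(1 − ρ₀) < θ′`) IMPLY
`NE5 outA outB W κ θ′ C₅` with the termwise END face's constant.  MI-R, L03, the structure binders and `TermRep` are DISCHARGED
inside (rows O1-c∕O1-e∕O1-f∕O1-d by name).  NOT a proof of NE5: an implication from displayed binders. -/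
theorem ne5_of_assembly {W : Set (ℕ → ℝ)} {ROp RHist : ℕ → ℝ} {a : ℕ → ι → ℝ}
    {κ G EA₀ E₀ E₁ cA cB c₁ r₀ δ' θ θ' ρ₀ B : ℝ} {k₀ : ℕ}
    (hT : 𝔄.TransportReads W)
    (hbB : 𝔄.SliceBudgetB W κ cB) (hbA : 𝔄.D.SliceBudget (𝔄.step (𝔄.bHist E₀ cB)) W κ cA)
    (hdA : DecayBound (𝔄.outA (𝔄.bHist E₀ cB)) W EA₀ κ) (hdB : DecayBound (𝔄.outB (𝔄.bHist E₀ cB)) W E₀ κ)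
    (hRA : RawBounded 𝔄.F 𝔄.rawAt W) (hRB : RawBounded 𝔄.F 𝔄.rawB W)
    (hwer : WeightedEntrywiseRate 𝔄.F 𝔄.rawAt 𝔄.rawB W c₁ fun k => θ ^ k) (hfl : ∀ k, r₀ ≤ 𝔄.rOp k)
    (hins : (𝔄.step (𝔄.bHist E₀ cB)).InsertionRate W κ E₀ δ' θ)
    (hbd : TermBound (ballClass (selfCtr 𝔄.raw 𝔄.histRef) ROp RHist) (term 𝔄.𝒯 𝔄.inc 𝔄.act) W κ a)
    (hbud : TermBudget a G) (hline : TermLineAnalytic (ballClass (selfCtr 𝔄.raw 𝔄.histRef) ROp RHist) (term 𝔄.𝒯 𝔄.inc 𝔄.act) W)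
    (hOp : ∀ k, 𝔄.rOp k ≤ ROp k) (hHist : ∀ k, 𝔄.bHist E₀ cB k + 𝔄.rHist k ≤ RHist k)
    (hE₀ : 0 ≤ E₀) (hE₁ : 0 < E₁) (hG : 0 ≤ G) (hcA : 0 ≤ cA) (hcB : 0 ≤ cB) (hc₁ : 0 ≤ c₁) (hr₀ : 0 < r₀) (hδ' : 0 ≤ δ')
    (hθ : 0 ≤ θ) (hθθ' : θ ≤ θ') (hθ'1 : θ' ≤ 1) (hω : 0 < 𝔄.D.ω) (hω1 : 𝔄.D.ω < 1) (hρ₀ : ρ₀ < 1)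
    (hnear : (c₁ / r₀ + δ') * θ ^ k₀ + cA * (EA₀ + E₀) / (1 - 𝔄.D.ω) ≤ ρ₀) (hB : 0 ≤ B)
    (hfirst : ∀ k < k₀, EA₀ + E₀ ≤ B * θ ^ k) (hsmall : 𝔄.D.ω + G / (1 - ρ₀) * cA < θ') :
    NE5 (𝔄.outA (𝔄.bHist E₀ cB)) (𝔄.outB (𝔄.bHist E₀ cB)) W κ θ'
      ((G / (1 - ρ₀) * (c₁ / r₀) + G / (1 - ρ₀) * δ' + B) * (θ' - 𝔄.D.ω) / (θ' - (𝔄.D.ω + G / (1 - ρ₀) * cA))) :=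
  ne5_at_of_stepModel_series_slack_budget_scale_nat (𝔄.step (𝔄.bHist E₀ cB)) (term 𝔄.𝒯 𝔄.inc 𝔄.act)
    (𝔄.representsA _ hT) (𝔄.representsB _ W) (Assembly.inBase hbB hdB hE₀ hcB hω.le hω1) (𝔄.baseBudget _ W)
    (fun k => by rw [Pi.zero_apply, zero_add]; exact hOp k) hHist (outIsSeriesOn_of_outIsSeries Assembly.outIsSeries _ W)
    hbd hbud hline hdA hdB (Assembly.operatorRate_of_weightedEntrywise hRA hRB hwer hc₁ hθ hfl hr₀) hins (𝔄.insAffine _ W)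
    (𝔄.insBlind _ W) (𝔄.insHomog _ W) (Assembly.insScaleBound hbA hω.le hE₁.le) hE₁ hG (div_nonneg hc₁ hr₀.le) hδ' hθ hθθ'
    hθ'1 hcA hω hρ₀ hnear hB hfirst hsmall

/-- [folklore] The same END with W1 read directly in MARGIN UNITS (`OperatorRate δ θ`, displayed) instead of the entry currency —
for consumers who hold row NE2's estimate in another currency (tower readings, O4-r fork). -/
theorem ne5_of_assembly_opRate {W : Set (ℕ → ℝ)} {ROp RHist : ℕ → ℝ} {a : ℕ → ι → ℝ}
    {κ G EA₀ E₀ E₁ cA cB δ δ' θ θ' ρ₀ B : ℝ} {k₀ : ℕ}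
    (hT : 𝔄.TransportReads W)
    (hbB : 𝔄.SliceBudgetB W κ cB) (hbA : 𝔄.D.SliceBudget (𝔄.step (𝔄.bHist E₀ cB)) W κ cA)
    (hdA : DecayBound (𝔄.outA (𝔄.bHist E₀ cB)) W EA₀ κ) (hdB : DecayBound (𝔄.outB (𝔄.bHist E₀ cB)) W E₀ κ)
    (hop : (𝔄.step (𝔄.bHist E₀ cB)).OperatorRate W δ θ) (hins : (𝔄.step (𝔄.bHist E₀ cB)).InsertionRate W κ E₀ δ' θ)
    (hbd : TermBound (ballClass (selfCtr 𝔄.raw 𝔄.histRef) ROp RHist) (term 𝔄.𝒯 𝔄.inc 𝔄.act) W κ a)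
    (hbud : TermBudget a G) (hline : TermLineAnalytic (ballClass (selfCtr 𝔄.raw 𝔄.histRef) ROp RHist) (term 𝔄.𝒯 𝔄.inc 𝔄.act) W)
    (hOp : ∀ k, 𝔄.rOp k ≤ ROp k) (hHist : ∀ k, 𝔄.bHist E₀ cB k + 𝔄.rHist k ≤ RHist k)
    (hE₀ : 0 ≤ E₀) (hE₁ : 0 < E₁) (hG : 0 ≤ G) (hcA : 0 ≤ cA) (hcB : 0 ≤ cB) (hδ : 0 ≤ δ) (hδ' : 0 ≤ δ')
    (hθ : 0 ≤ θ) (hθθ' : θ ≤ θ') (hθ'1 : θ' ≤ 1) (hω : 0 < 𝔄.D.ω) (hω1 : 𝔄.D.ω < 1) (hρ₀ : ρ₀ < 1)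
    (hnear : (δ + δ') * θ ^ k₀ + cA * (EA₀ + E₀) / (1 - 𝔄.D.ω) ≤ ρ₀) (hB : 0 ≤ B)
    (hfirst : ∀ k < k₀, EA₀ + E₀ ≤ B * θ ^ k) (hsmall : 𝔄.D.ω + G / (1 - ρ₀) * cA < θ') :
    NE5 (𝔄.outA (𝔄.bHist E₀ cB)) (𝔄.outB (𝔄.bHist E₀ cB)) W κ θ'
      ((G / (1 - ρ₀) * δ + G / (1 - ρ₀) * δ' + B) * (θ' - 𝔄.D.ω) / (θ' - (𝔄.D.ω + G / (1 - ρ₀) * cA))) :=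
  ne5_at_of_stepModel_series_slack_budget_scale_nat (𝔄.step (𝔄.bHist E₀ cB)) (term 𝔄.𝒯 𝔄.inc 𝔄.act)
    (𝔄.representsA _ hT) (𝔄.representsB _ W) (Assembly.inBase hbB hdB hE₀ hcB hω.le hω1) (𝔄.baseBudget _ W)
    (fun k => by rw [Pi.zero_apply, zero_add]; exact hOp k) hHist (outIsSeriesOn_of_outIsSeries Assembly.outIsSeries _ W)
    hbd hbud hline hdA hdB hop hins (𝔄.insAffine _ W) (𝔄.insBlind _ W) (𝔄.insHomog _ W)
    (Assembly.insScaleBound hbA hω.le hE₁.le) hE₁ hG hδ hδ' hθ hθθ' hθ'1 hcA hω hρ₀ hnear hB hfirst hsmall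

end Summit.QuantumFields.BalabanUV.T4Continuum.B13StepEnd
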